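import Mathlib
import Literature.Computability.AlgebraicComplexity.PermanentIrreducible
import Literature.Computability.AlgebraicComplexity.StandardFamiliesProofs
import Summits.ValiantsHypothesis.ValiantsHypothesis.Theorems.DivisionGapPerCofactorDegreeReductionStubNegativeCompensation

/-!
# Crux `DivisionGap.PerCofactorDegreeReduction` (stmt-ValiantsHypothesis-15046), line `Sketch` —
# stub `stub_nonnegRepresentative`: nonnegative representability modulo `per_n`

**Theorem (`stub_nonnegRepresentative`).** Let `F ∈ ℝ[x_ij]` (`n × n` variables) be a form of
degree `d`.  Then `F` is congruent modulo `per_n` to a form `P ∈ ℝ≥0[x_ij]` of degree `d`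
(i.e. `map toReal P = F + per_n · H` for some real `H`) if and only if the coefficients of `F` at
all MATCHING-FREE exponents `m` (those with `μ_σ ≰ m` for every permutation `σ`, where
`μ_σ = permMonomial σ` is the exponent of the permutation monomial `∏_i x_{σ i, i}`) are `≥ 0`.

## Proof

*Necessity.*  By `NegativeCompensation.coeff_perPoly_mul`,
`coeff m (per_n · H) = Σ_τ [μ_τ ≤ m] · coeff (m − μ_τ) H`, which vanishes at a matching-free `m`
(`coeff_perPoly_mul_of_matchingFree`): matching-free coefficients are invariants of the residue
class of `F`, and those of `map toReal P` are `≥ 0`.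

*Sufficiency.*  Every exponent `μ` with `F_μ < 0` dominates some `μ_{σ(μ)}` (contrapositive of the
hypothesis).  Put `G := Σ_{μ : F_μ < 0} (−F_μ) · x^{μ − μ_{σ(μ)}}` and `P' := F + per_n · G`.
All coefficients of `G` are `≥ 0`, hence so are those of `per_n · G`; and at an exponent `e` with
`F_e < 0` the `τ = σ(e)` term of `coeff e (per_n · G)` is `coeff (e − μ_{σ(e)}) G ≥ −F_e`, so
`coeff e P' ≥ 0`.  Each summand `per_n · x^{μ − μ_{σ(μ)}}` is a form of degree
`|μ_{σ(μ)}| + |μ − μ_{σ(μ)}| = |μ| = d` (all permutation monomials have the degree of `per_n`,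
`perPoly_isHomogeneous`), so `P'` is a form of degree `d`.  Finally a real polynomial with
nonnegative coefficients lifts to `ℝ≥0[x]` (`exists_lift_of_coeff_nonneg`, via
`MvPolynomial.mem_range_map_iff_coeffs_subset`), and homogeneity transfers along the injective
coefficient map `toReal`.

Design: no definitions; everything is over `Fin n` for all `n, d` (at `N = ∅` the correction is
`G = 0`).  Leans on Mathlib, `Literature/Computability/AlgebraicComplexity/PermanentIrreducible.lean`
(`permMonomial`, `coeff_permMonomial_perPoly`), `StandardFamilies.lean` (`perPoly_isHomogeneous`) and
the sibling stub file `…StubNegativeCompensation.lean` (`coeff_perPoly_mul`).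
-/

noncomputable section

-- `Summit.ValiantsHypothesis.ValiantsHypothesis.…` is the tree's mandated single-conjunct layout
-- (Problem = Summit), so the duplicated namespace component is intended.
set_option linter.dupNamespace false

namespace Summit.ValiantsHypothesis.ValiantsHypothesis.Theorems.DivisionGap.PerCofactorDegreeReduction.NonnegRepresentative

open MvPolynomial Literature.Computability.AlgebraicComplexity
open scoped NNReal BigOperators

variable {n : ℕ}

/-! ### Matching-free coefficients are invariants modulo `per_n` -/

/-- **Matching-free coefficients of a multiple of the permanent vanish.**  If no permutation
monomial `μ_σ` lies below `m`, then `coeff m (per_n · H) = 0` for every real `H`: every term of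
`coeff_perPoly_mul` has a false guard. [folklore] -/
theorem coeff_perPoly_mul_of_matchingFree {m : (Fin n × Fin n) →₀ ℕ}
    (hm : ∀ σ : Equiv.Perm (Fin n), ¬ permMonomial σ ≤ m) (H : MvPolynomial (Fin n × Fin n) ℝ) :
    coeff m (perPoly (Fin n) ℝ * H) = 0 := by
  rw [NegativeCompensation.coeff_perPoly_mul]
  exact Finset.sum_eq_zero fun τ _ => if_neg (hm τ)

/-! ### Degrees -/

/-- **All permutation monomials have the degree of the permanent**: `|μ_σ| = card (Fin n)`, read
off from `perPoly_isHomogeneous` at the exponent `μ_σ`, whose coefficient in `per_n` is `1`.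
[folklore] -/
theorem weight_permMonomial (σ : Equiv.Perm (Fin n)) :
    Finsupp.weight (1 : Fin n × Fin n → ℕ) (permMonomial σ) = Fintype.card (Fin n) :=
  perPoly_isHomogeneous (n := Fin n) (k := ℝ)
    (by rw [coeff_permMonomial_perPoly]; exact one_ne_zero)

/-- **The correction terms are forms of the right degree**: if `μ_σ ≤ μ` and `|μ| = d` then
`per_n · c x^{μ − μ_σ}` is homogeneous of degree `|μ_σ| + |μ − μ_σ| = |μ| = d`. [folklore] -/
theorem perPoly_mul_monomial_isHomogeneous {μ : (Fin n × Fin n) →₀ ℕ} {σ : Equiv.Perm (Fin n)}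
    (hσ : permMonomial σ ≤ μ) (c : ℝ) {d : ℕ}
    (hμ : Finsupp.weight (1 : Fin n × Fin n → ℕ) μ = d) :
    (perPoly (Fin n) ℝ * monomial (μ - permMonomial σ) c).IsHomogeneous d := by
  have hmono : (monomial (μ - permMonomial σ) c).IsHomogeneous
      (Finsupp.weight (1 : Fin n × Fin n → ℕ) (μ - permMonomial σ)) :=
    isHomogeneous_monomial _ (by rw [Finsupp.degree_eq_weight_one]; rfl)
  have h := (perPoly_isHomogeneous (n := Fin n) (k := ℝ)).mul hmono
  rwa [← weight_permMonomial σ, ← map_add, add_tsub_cancel_of_le hσ, hμ] at h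

/-! ### Lifting nonnegative real polynomials to `ℝ≥0[x]` -/

/-- A real polynomial with nonnegative coefficients lifts to `ℝ≥0[x]` along `map toReal`
(`MvPolynomial.mem_range_map_iff_coeffs_subset`). [folklore] -/
theorem exists_lift_of_coeff_nonneg {ι : Type*} (q : MvPolynomial ι ℝ)
    (hq : ∀ m, 0 ≤ coeff m q) :
    ∃ p : MvPolynomial ι ℝ≥0, MvPolynomial.map NNReal.toRealHom p = q := by
  have h : q ∈ Set.range (MvPolynomial.map NNReal.toRealHom (σ := ι)) := by
    rw [mem_range_map_iff_coeffs_subset]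
    intro c hc
    obtain ⟨m, -, rfl⟩ := mem_coeffs_iff.mp (Finset.mem_coe.mp hc)
    exact ⟨⟨coeff m q, hq m⟩, rfl⟩
  obtain ⟨p, hp⟩ := h
  exact ⟨p, hp⟩

/-- Homogeneity descends along `map toReal : ℝ≥0[x] → ℝ[x]` (the coefficient map is injective, so
`p` and `map toReal p` have the same nonzero coefficients). [folklore] -/
theorem isHomogeneous_of_map_toRealHom {ι : Type*} (p : MvPolynomial ι ℝ≥0) {d : ℕ}
    (h : (MvPolynomial.map NNReal.toRealHom p).IsHomogeneous d) : p.IsHomogeneous d := by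
  intro e he
  apply h
  rw [coeff_map, NNReal.coe_toRealHom]
  exact NNReal.coe_ne_zero.mpr he

/-! ### The stub -/

/-- **stub_nonnegRepresentative — nonnegative representability modulo `per_n`.**  A real form `F`
of degree `d` is congruent modulo `per_n` to a NONNEGATIVE form of degree `d` iff its coefficients
on MATCHING-FREE exponents (those dominating no permutation monomial `μ_σ`) are nonnegative.
Necessity: matching-free coefficients are invariants of the class of `F`
(`coeff_perPoly_mul_of_matchingFree`) and those of `map toReal P` are `≥ 0`.  Sufficiency: every
exponent `μ` with `F_μ < 0` dominates some `μ_{σ(μ)}`; `P' := F + per_n · Σ_{μ : F_μ < 0} (−F_μ) x^{μ − μ_{σ(μ)}}`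
has nonnegative coefficients (the `τ = σ(μ)` term restores `F_μ` to `≥ F_μ + (−F_μ) = 0`, every
other contribution is `≥ 0`), is a form of degree `d` (`perPoly_mul_monomial_isHomogeneous`), and
lifts to `ℝ≥0[x]` (`exists_lift_of_coeff_nonneg`, `isHomogeneous_of_map_toRealHom`).
[prime-walk-positivizer] -/
theorem stub_nonnegRepresentative (n d : ℕ) (F : MvPolynomial (Fin n × Fin n) ℝ)
    (hF : F.IsHomogeneous d) :
    (∃ (P : MvPolynomial (Fin n × Fin n) ℝ≥0) (H : MvPolynomial (Fin n × Fin n) ℝ),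
        P.IsHomogeneous d ∧ MvPolynomial.map NNReal.toRealHom P = F + perPoly (Fin n) ℝ * H) ↔
    ∀ m : (Fin n × Fin n) →₀ ℕ, (∀ σ : Equiv.Perm (Fin n), ¬ permMonomial σ ≤ m) →
      0 ≤ coeff m F := by
  constructor
  · -- necessity: matching-free coefficients of `F` are those of `map toReal P`
    rintro ⟨P, H, -, hPF⟩ m hm
    have h := congrArg (coeff m) hPF
    rw [coeff_add, coeff_perPoly_mul_of_matchingFree hm, add_zero, coeff_map,
      NNReal.coe_toRealHom] at h
    rw [← h]
    exact NNReal.coe_nonneg _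
  · intro hpos
    -- a matching below every exponent carrying a negative coefficient
    have hex : ∀ μ : (Fin n × Fin n) →₀ ℕ, coeff μ F < 0 →
        ∃ σ : Equiv.Perm (Fin n), permMonomial σ ≤ μ := by
      intro μ hμ
      by_contra h
      push Not at h
      exact absurd (hpos μ h) (not_le.mpr hμ)
    choose! σ hσ using hex
    -- the negative exponents
    obtain ⟨N, hN⟩ : ∃ N : Finset ((Fin n × Fin n) →₀ ℕ), ∀ μ, μ ∈ N ↔ coeff μ F < 0 := by
      refine ⟨F.support.filter (fun μ => coeff μ F < 0), fun μ => ?_⟩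
      simp only [Finset.mem_filter, mem_support_iff, and_iff_right_iff_imp]
      exact fun h => h.ne
    -- the correction `G` and its coefficients
    obtain ⟨G, hG⟩ : ∃ G : MvPolynomial (Fin n × Fin n) ℝ,
        G = ∑ μ ∈ N, monomial (μ - permMonomial (σ μ)) (-coeff μ F) := ⟨_, rfl⟩
    have hGcoeff : ∀ ν, coeff ν G =
        ∑ μ ∈ N, if μ - permMonomial (σ μ) = ν then -coeff μ F else 0 := by
      intro ν
      simp only [hG, coeff_sum, coeff_monomial]
    have hGterm : ∀ ν, ∀ μ ∈ N,
        (0 : ℝ) ≤ if μ - permMonomial (σ μ) = ν then -coeff μ F else 0 := by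
      intro ν μ hμ
      split_ifs
      · linarith [(hN μ).1 hμ]
      · exact le_rfl
    have hGnonneg : ∀ ν, 0 ≤ coeff ν G := fun ν => by
      rw [hGcoeff]
      exact Finset.sum_nonneg (hGterm ν)
    have hGlow : ∀ μ ∈ N, -coeff μ F ≤ coeff (μ - permMonomial (σ μ)) G := by
      intro μ hμ
      rw [hGcoeff]
      have h : (if μ - permMonomial (σ μ) = μ - permMonomial (σ μ) then -coeff μ F else 0) ≤
          ∑ μ' ∈ N, (if μ' - permMonomial (σ μ') = μ - permMonomial (σ μ) then -coeff μ' F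
            else 0) :=
        Finset.single_le_sum (hGterm (μ - permMonomial (σ μ))) hμ
      rwa [if_pos rfl] at h
    -- `P' := F + per_n · G` has nonnegative coefficients
    have hP'nonneg : ∀ e, 0 ≤ coeff e (F + perPoly (Fin n) ℝ * G) := by
      intro e
      rw [coeff_add, NegativeCompensation.coeff_perPoly_mul]
      have hterm : ∀ τ ∈ (Finset.univ : Finset (Equiv.Perm (Fin n))),
          (0 : ℝ) ≤ if permMonomial τ ≤ e then coeff (e - permMonomial τ) G else 0 := by
        intro τ _
        split_ifs
        · exact hGnonneg _
        · exact le_rfl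
      by_cases he : coeff e F < 0
      · have h1 : (if permMonomial (σ e) ≤ e then coeff (e - permMonomial (σ e)) G else 0) ≤
            ∑ τ, (if permMonomial τ ≤ e then coeff (e - permMonomial τ) G else 0) :=
          Finset.single_le_sum hterm (Finset.mem_univ (σ e))
        rw [if_pos (hσ e he)] at h1
        linarith [hGlow e ((hN e).2 he)]
      · push Not at he
        exact add_nonneg he (Finset.sum_nonneg hterm)
    -- `P'` is a form of degree `d`
    have hP'hom : (F + perPoly (Fin n) ℝ * G).IsHomogeneous d := by
      refine hF.add ?_
      rw [hG, Finset.mul_sum]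
      refine IsHomogeneous.sum _ _ _ fun μ hμ => ?_
      have hμF : coeff μ F ≠ 0 := ((hN μ).1 hμ).ne
      exact perPoly_mul_monomial_isHomogeneous (hσ μ ((hN μ).1 hμ)) _ (hF hμF)
    -- lift `P'` to `ℝ≥0[x]`
    obtain ⟨P, hP⟩ := exists_lift_of_coeff_nonneg _ hP'nonneg
    exact ⟨P, G, isHomogeneous_of_map_toRealHom P (hP ▸ hP'hom), hP⟩

end Summit.ValiantsHypothesis.ValiantsHypothesis.Theorems.DivisionGap.PerCofactorDegreeReduction.NonnegRepresentative

end
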